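import Literature.AlgebraicGeometry.HodgeTheory.TransvectionMonodromyZariskiDense
import HarnessLib

/-!
# A square-zero unipotent in `Γ` puts its whole one-parameter line in the identity component of the Zariski
# closure of `Γ` (Borel I.2.1; CMSP Lemma–Def. 15.3.7 — the «INF_e ∕ u₀» input of quaternionic reflection density)

Family `hodge`, layer `Literature/AlgebraicGeometry/HodgeTheory`. THEOREMS only (no definition, no named fact). Written by the
prover seat `hodge-nonav-prover-Ax` (g16, cell `hodge-nonav`) for crux K1Q of route `Q8SymplecticPowers` (p3 g36's (o4′) BQ-IRR,
hypothesis h_unip: the census' square-zero unipotent local monodromy `u₀`), generic.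

* `coe_pow_eq_one_add_smul_of_sq_zero` — `(1 + n)^k = 1 + k·n` for `n² = 0`.
* `mem_glZariskiClosure_of_sq_zero_unipotent` — if `u ∈ Γ ≤ GL(V)` has `u = 1 + n` with `n² = 0` (characteristic `0`), then every
  automorphism `w` with `w = 1 + t·n`, `t ∈ K`, lies in `glZariskiClosure Γ` (the powers `u^k = 1 + k·n` are infinitely many points of
  the line; `one_add_smul_mem_zariskiClosureEndOfBasis`).
* `mem_glIdentityComponent_of_sq_zero_unipotent` — the same inside `glIdentityComponent Γ` (a finite-index `Γ'` contains `u^m`,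
  `m ≥ 1`, again square-zero unipotent with `n' = m·n`).

## References
* [Borel1991] A. Borel, Linear Algebraic Groups, 2nd ed., I.2.1 (closure of the group generated by a unipotent element).
* [CarlsonMullerStachPeters2017] Carlson–Müller-Stach–Peters, Period Mappings and Period Domains, 2nd ed., Lemma–Def. 15.3.7.
-/

noncomputable section

namespace Literature.AlgebraicGeometry.HodgeTheory

open Literature.AlgebraicGeometry.Motives

universe u v

variable {K : Type u} [Field K] {V : Type v} [AddCommGroup V] [Module K V]

/-- `(1 + n)^k = 1 + k·n` for a square-zero `n`. [cite: Borel1991, I.2.1] -/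
theorem coe_pow_eq_one_add_smul_of_sq_zero {n : Module.End K V} (hn : n * n = 0) {u : V ≃ₗ[K] V}
    (hu : (u : Module.End K V) = 1 + n) (k : ℕ) : ((u ^ k : V ≃ₗ[K] V) : Module.End K V) = 1 + (k : K) • n := by
  induction k with
  | zero => rw [pow_zero, Nat.cast_zero, zero_smul, add_zero]; rfl
  | succ k ih =>
    rw [pow_succ, LinearEquiv.coe_toLinearMap_mul, ih, hu, Nat.cast_succ, add_mul, mul_add, mul_add, one_mul, mul_one,
      smul_mul_assoc, hn, smul_zero, add_zero, add_smul, one_smul, add_assoc, one_mul, add_comm n]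

variable [CharZero K] [Module.Finite K V]

/-- **A square-zero unipotent puts its line in the Zariski closure**: `u = 1 + n ∈ Γ`, `n² = 0` ⇒ every `w = 1 + t·n` lies in
`glZariskiClosure Γ`. [cite: Borel1991, I.2.1] [cite: CarlsonMullerStachPeters2017, Lemma–Definition 15.3.7] -/
theorem mem_glZariskiClosure_of_sq_zero_unipotent {Γ : Subgroup (V ≃ₗ[K] V)} {n : Module.End K V} (hn : n * n = 0)
    {u : V ≃ₗ[K] V} (hu : (u : Module.End K V) = 1 + n) (huΓ : u ∈ Γ) {t : K} {w : V ≃ₗ[K] V}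
    (hw : (w : Module.End K V) = 1 + t • n) : w ∈ glZariskiClosure Γ := by
  classical
  let bV := Module.Free.chooseBasis K V
  set S : Set (Module.End K V) := (fun h : V ≃ₗ[K] V => (h : Module.End K V)) '' (Γ : Set (V ≃ₗ[K] V)) with hSdef
  have hline : (1 : Module.End K V) + t • n ∈ zariskiClosureEndOfBasis bV S := by
    refine one_add_smul_mem_zariskiClosureEndOfBasis bV n ?_ t
    have hinj : Function.Injective fun k : ℕ => (k : K) := Nat.cast_injective
    refine (Set.infinite_range_of_injective hinj).mono ?_
    rintro _ ⟨k, rfl⟩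
    exact ⟨u ^ k, Γ.pow_mem huΓ k, coe_pow_eq_one_add_smul_of_sq_zero hn hu k⟩
  rw [mem_glZariskiClosure_iff, ← zariskiClosureEnd_basis_indep bV, hw]
  exact hline

/-- **… and in the identity component**: under the same hypotheses every `w = 1 + t·n` lies in `glIdentityComponent Γ` — a
finite-index `Γ' ≤ Γ` contains `u^m` for some `m ≥ 1`, which is `1 + n'` with `n' = m·n` square-zero, and `t·n = (t/m)·n'`.
[cite: Borel1991, I.2.1] [cite: CarlsonMullerStachPeters2017, Lemma–Definition 15.3.7 and proof of Proposition 15.3.9] -/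
theorem mem_glIdentityComponent_of_sq_zero_unipotent {Γ : Subgroup (V ≃ₗ[K] V)} {n : Module.End K V} (hn : n * n = 0)
    {u : V ≃ₗ[K] V} (hu : (u : Module.End K V) = 1 + n) (huΓ : u ∈ Γ) {t : K} {w : V ≃ₗ[K] V}
    (hw : (w : Module.End K V) = 1 + t • n) : w ∈ glIdentityComponent Γ := by
  rw [mem_glIdentityComponent_iff]
  intro Γ' _ hfi
  obtain ⟨m, hm0, -, hm⟩ := Subgroup.exists_pow_mem_of_index_ne_zero hfi.index_ne_zero (⟨u, huΓ⟩ : Γ)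
  rw [Subgroup.mem_subgroupOf, Subgroup.coe_pow] at hm
  have hm' : ((u ^ m : V ≃ₗ[K] V) : Module.End K V) = 1 + (m : K) • n := coe_pow_eq_one_add_smul_of_sq_zero hn hu m
  have hn' : ((m : K) • n) * ((m : K) • n) = 0 := by rw [smul_mul_smul_comm, hn, smul_zero]
  have hmK : (m : K) ≠ 0 := Nat.cast_ne_zero.2 hm0.ne'
  refine mem_glZariskiClosure_of_sq_zero_unipotent hn' hm' hm (t := t / m) ?_
  rw [hw, smul_smul, div_mul_cancel₀ t hmK]

end Literature.AlgebraicGeometry.HodgeTheory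

end
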